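import Literature.NumberTheory.FaltingsSerre.Paramodular277
import HarnessLib

/-!
# The Faltings–Serre method after Brumer–Pacetti–Poor–Tornaría–Voight–Yuen, VI:
# the INSTANCE TEMPLATE `paramodular_of_surfaceCertificate` (level `N`, check primes `T`)

[BPPTVY] = A. Brumer, A. Pacetti, C. Poor, G. Tornaría, J. Voight, D. S. Yuen, *On the paramodularity of
typical abelian surfaces*, Algebra & Number Theory **13**:5 (2019) 1145–1195 [cite: BrumerEtAl2019]
(PRINTED numbering and pages).  Verbatim, Theorem 1.1.1 p. 1146 / Thm 7.1.3, Thm 7.2.1 pp. 1187–1189: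
"Let `C₂₇₇` be the curve defined by (1.1.2), respectively `C₃₅₃`, `C₅₈₇` … Then the Jacobian is
paramodular of level `N`: `L(A,s) = L(f,s,spin)`"; the proof of Thm 7.1.3 (p. 1187–1188) runs the
extended Faltings–Serre method [Alg 2.4.1] with `S = {2, N}` and outputs a finite set of check primes
(`3, 5, …, 43` for `N = 277`); §7.2 "we verify paramodularity for `N = 353, 587` in the same way".

THIS FILE is the instance-independent half of `Paramodular277.lean`: the kernel-checked assembly
`isParamodularAwayFrom_of_certificate` (`ParamodularBridge.lean`) SPECIALISED to the shape in which
every instance (`N = 277, 353, 587`, and any further typical prime level) supplies its data —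
* `placesOver T` — the places of `ℚ` above a finite set `T` of rational primes (= the
  `Paramodular277.placesAbove` of the `277` file, `placesOver_eq`);
* `SurfaceCertificate N T J ν ρA ρf` — THE CERTIFICATE HYPOTHESIS of level `N` with check-prime set
  `T`: `Certificate (placesOver ({2} ∪ primes of N)) (placesOver T) J ν ρA ρf`, i.e. the binders of the
  cited criterion [BPPTVY, Thm 2.1.5 / Alg 2.4.1] for the pair (`ρA`, `ρf`) with `S` = the places above
  `2N` and `P` = the places above `T` (fields `similitude₁₂`, `det_isUnit`, `transpose_eq`, `diag_eq`,
  `unramified₁₂`, `absIrreducible`, `residual_eq`, `complete`, `traces` of `ParamodularCertificate.lean`);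
  it is a HYPOTHESIS, discharged outside the kernel by a twice-computed certificate file whose hash the
  instance's docstring must carry (ABSOLUTE RULE of cell pub-paramod) — `certificate277_iff` checks that
  `Certificate277` is literally `SurfaceCertificate 277 {3,5,…,43}`;
* `paramodular_of_surfaceCertificate` — for ANY level `N ≥ 1` and check set `T`: from the cited
  criterion `hFS`, a certificate `hC`, the curve side (`hframe`, `hA`: `ρA` frames `T₂A ⊗ ℚ₂` and
  `L_p(A,T) = 1 − aA p T + bA p T² − p aA p T³ + p² T⁴` at every `p ∤ N`, (4.1.3)–(4.1.5)), the form side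
  (`hρf`: an integral form of `ρ_{f,2}` in `ρ̄A`'s frame with Frobenius polynomials `X⁴Q_p(f,1/X)` at
  `p ∤ 2N` — [BPPTVY, Thm 4.3.4, ARTHUR-DEPENDENT, + Lemma 4.3.8(b) p. 1171]; `hcusp`, `hne`, `hfe`:
  `0 ≠ f ∈ S₂(K(N))` with spinor Euler factors `Q_p(f,T) = 1 − af p T + bf p T² − p af p T³ + p²T⁴`,
  (4.2.18)) and the hand check `h2 : L_2(A,T) = Q_2(f,T)` (needed only when `2 ∤ N`):
  `IsParamodularAwayFrom A N f` — `L_p(A,T) = Q_p(f,T)` for every prime `p ∤ N`;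
* `eulerFactors_agree` — the conclusion unfolded at one prime.
So an instance file is: its `CertificateData` print record (if printed), `def CertificateN := 
SurfaceCertificate N T`, and `theorem paramodular_N := paramodular_of_surfaceCertificate …` — no
further kernel work; `paramodular_277` is re-derived this way below (`paramodular_277'`).
What is hypothesis / what is proved, the Arthur dependence of `hρf`, the meaning of "away from `N`"
and the placement under `Literature/` are exactly as documented in `Paramodular277.lean` (cell
DIVERGENCE.md D-4, D-7, D-11, D-12, D-13).  Axioms ⊆ {propext, Classical.choice, Quot.sound}.

## References
* [BPPTVY] ANT 13:5 (2019): Thm 1.1.1 p. 1146; Thm 2.1.5 p. 1150; Alg 2.4.1 p. 1156; (4.1.3)–(4.1.5)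
  pp. 1163–1164; (4.2.18) p. 1168; Thm 4.3.4 p. 1169; Lemma 4.3.6 p. 1170; Lemma 4.3.8 p. 1171; Thm 7.1.3, Lemma 7.1.4,
  Thm 7.2.1 pp. 1187–1189. [cite: BrumerEtAl2019]
-/

noncomputable section

namespace Literature.NumberTheory.FaltingsSerre

open Polynomial IsDedekindDomain
open Literature.NumberTheory.GaloisRepresentations
  Literature.NumberTheory.Automorphic.Paramodular Literature.NumberTheory.Automorphic
  Literature.AlgebraicGeometry.Motives
open scoped NumberField

/-- The places of `ℚ` lying above a finite set `T` of rational primes. [folklore] -/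
def placesOver (T : Finset ℕ) : Set (HeightOneSpectrum (𝓞 ℚ)) :=
  {v | ∃ q ∈ T, ((q : ℕ) : 𝓞 ℚ) ∈ v.asIdeal}

/-- Unfolding lemma. [folklore] -/
theorem mem_placesOver {T : Finset ℕ} {v : HeightOneSpectrum (𝓞 ℚ)} :
    v ∈ placesOver T ↔ ∃ q ∈ T, ((q : ℕ) : 𝓞 ℚ) ∈ v.asIdeal :=
  Iff.rfl

/-- `placesOver` is monotone in `T`. [folklore] -/
theorem placesOver_mono {T T' : Finset ℕ} (h : T ⊆ T') : placesOver T ⊆ placesOver T' :=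
  fun _ ⟨q, hq, hv⟩ => ⟨q, h hq, hv⟩

/-- The `277` file's `placesAbove` is `placesOver`. [folklore] -/
theorem placesOver_eq (T : Finset ℕ) : Paramodular277.placesAbove T = placesOver T :=
  rfl

/-- The bad primes `{2} ∪ {p : p ∣ N}` of the method at level `N` (`ℓ = 2`): `S` = the places above
`2N` [BPPTVY, proof of Thm 7.1.3 p. 1187: "unramified outside `{2, 277}`"]. [cite: BrumerEtAl2019, Thm 7.1.3 p. 1187] -/
def badPrimes (N : ℕ) : Finset ℕ :=
  insert 2 N.primeFactors

/-- For a prime level `N`, the bad primes are `{2, N}`. [cite: BrumerEtAl2019, Thm 7.1.3 p. 1187] -/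
theorem badPrimes_of_prime {N : ℕ} (hN : N.Prime) : badPrimes N = {2, N} := by
  simp [badPrimes, hN.primeFactors]

/-- **The certificate hypothesis of level `N` with check-prime set `T`.**
`SurfaceCertificate N T J ν ρA ρf := Certificate (placesOver (badPrimes N)) (placesOver T) J ν ρA ρf`:
the binders of the criterion [BPPTVY, Thm 2.1.5 / Alg 2.4.1] for the framed `2`-adic representations
`ρA`, `ρf` with `S` = places above `2N`, `P` = places above `T`, Gram matrix `J`, multiplier `ν`
(structure `Certificate` of `ParamodularCertificate.lean`).  A HYPOTHESIS — discharged outside the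
kernel by the instance's twice-computed certificate file (cell schema `certs/SCHEMA.md` and the
JSON↔Lean map of DIVERGENCE.md: blocks `residual` ↦ `absIrreducible`, `residual_eq`; `classfield`,
`group_theory`, `obstructing` ↦ `complete` with `P = placesOver T`, `T = verdict.sufficient_primes`;
`trace_check` ↦ `traces`; (4.1.3)/Thm 4.3.4(ii) ↦ `unramified₁₂`, `similitude₁₂`), whose sha256 the
instance docstring records. [cite: BrumerEtAl2019, Alg 2.4.1 p. 1156; Thm 7.1.3 p. 1187] -/
def SurfaceCertificate (N : ℕ) (T : Finset ℕ) (J : Matrix (Fin 4) (Fin 4) ℤ_[2])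
    (ν : Field.absoluteGaloisGroup ℚ → ℤ_[2]) (ρA ρf : FramedGaloisRep ℚ ℤ_[2] 4) : Prop :=
  Certificate (placesOver (badPrimes N)) (placesOver T) J ν ρA ρf

/-- Consistency with the landed `N = 277` instance: `Certificate277` IS `SurfaceCertificate 277`
with `T` = the thirteen printed check primes. [cite: BrumerEtAl2019, Thm 7.1.3 pp. 1187–1188] -/
theorem certificate277_iff (J : Matrix (Fin 4) (Fin 4) ℤ_[2]) (ν : Field.absoluteGaloisGroup ℚ → ℤ_[2])
    (ρA ρf : FramedGaloisRep ℚ ℤ_[2] 4) :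
    Paramodular277.Certificate277 J ν ρA ρf ↔
      SurfaceCertificate 277 data277.checkPrimes.toFinset J ν ρA ρf := by
  have h277 : Nat.Prime 277 := by norm_num
  simp only [Paramodular277.Certificate277, SurfaceCertificate, Paramodular277.S277,
    Paramodular277.P277, placesOver_eq, badPrimes_of_prime h277]

/-- **`A` is paramodular of level `N` away from `N`, from a surface certificate** — THE INSTANCE
TEMPLATE.  For an abelian surface `A/ℚ` whose `2`-adic Tate module is framed by `ρA` (`hframe`,
(4.1.3)) with good Euler factors `L_p(A,T) = 1 − aA p T + bA p T² − p aA p T³ + p²T⁴` at every prime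
`p ∤ N` (`hA`, (4.1.4)–(4.1.5): this is where "`cond A ∣ N^∞`" enters); an integral form `ρf` of
`ρ_{f,2}` in `ρ̄A`'s frame with Frobenius polynomials `X⁴Q_p(f,1/X)` at `p ∤ 2N` (`hρf`:
[BPPTVY, Thm 4.3.4 — ARTHUR-DEPENDENT — + Lemma 4.3.8(b) p. 1171], an INPUT); a nonzero `f ∈ S₂(K(N))` with
spinor Euler factors `Q_p(f,T) = 1 − af p T + bf p T² − p af p T³ + p²T⁴` at `p ∤ N` (`hcusp`, `hne`,
`hfe`, (4.2.18)); the hand check `L_2(A,T) = Q_2(f,T)` when `2 ∤ N` (`h2`); the CITED criterion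
(`hFS`, [Thm 2.1.5]) and a certificate (`hC`): then `L_p(A,T) = Q_p(f,T)` for every prime `p ∤ N`.
Proof = `isParamodularAwayFrom_of_certificate` with `LA p := lPolynomialOfSurface p (aA p) (bA p)`,
`Qf p := lPolynomialOfSurface p (af p) (bf p)` (constant coefficients `1`).
[cite: BrumerEtAl2019, Thm 7.1.3 p. 1187; Thm 7.2.1 p. 1189; Thm 2.1.5 p. 1150; Thm 4.3.4 p. 1169] -/
theorem paramodular_of_surfaceCertificate (hFS : traceEq_of_faltingsSerre_symplectic)
    {N : ℕ} [NeZero N] {T : Finset ℕ}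
    {A : AbelianVariety ℚ} {f : Matrix (Fin 2) (Fin 2) ℂ → ℂ}
    {ρA ρf : FramedGaloisRep ℚ ℤ_[2] 4} {J : Matrix (Fin 4) (Fin 4) ℤ_[2]}
    {ν : Field.absoluteGaloisGroup ℚ → ℤ_[2]}
    {b : Module.Basis (Fin 4) ℚ_[2] (A.rationalTateModule 2)}
    (hC : SurfaceCertificate N T J ν ρA ρf)
    (hframe : A.IsFrameOfTateRep 2 b (rationalize ρA))
    (aA bA af bf : ℕ → ℤ)
    (hA : ∀ p : ℕ, p.Prime → ¬ p ∣ N →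
      A.HasGoodEulerFactorAt p ((lPolynomialOfSurface p (aA p) (bA p)).map (Int.castRingHom ℚ)))
    (hρf : ∀ p : ℕ, p.Prime → ¬ p ∣ N → p ≠ 2 →
      ∀ v : HeightOneSpectrum (𝓞 ℚ), ((p : ℕ) : 𝓞 ℚ) ∈ v.asIdeal →
        ρf.HasFrobCharpolyAt v
          ((lPolynomialOfSurface p (af p) (bf p)).reverse.map (Int.castRingHom ℤ_[2])))
    (hcusp : IsParamodularCuspForm N 2 f) (hne : ∃ Z ∈ siegelUpperHalfSpace 2, f Z ≠ 0)
    (hfe : ∀ p : ℕ, p.Prime → ¬ p ∣ N →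
      HasSpinorEulerFactorAt 2 p f ((lPolynomialOfSurface p (af p) (bf p)).map (Int.castRingHom ℂ)))
    (h2 : ¬ 2 ∣ N → aA 2 = af 2 ∧ bA 2 = bf 2) :
    IsParamodularAwayFrom A N f :=
  isParamodularAwayFrom_of_certificate hFS hC hframe
    (fun p => lPolynomialOfSurface p (aA p) (bA p)) (fun p => lPolynomialOfSurface p (af p) (bf p))
    (fun p => by rw [lPolynomialOfSurface_coeff_zero]; exact one_ne_zero)
    (fun p => by rw [lPolynomialOfSurface_coeff_zero]; exact one_ne_zero)
    hA hρf hcusp hne hfe (fun h2N => by simp only [(h2 h2N).1, (h2 h2N).2])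

/-- The conclusion unfolded at one prime `p ∤ N`: ONE polynomial `Q ∈ ℚ[T]` is both the spinor Euler
factor of `f` and the good Euler factor of `A` at `p` — "`L_p(A,T) = Q_p(f,T)`". [cite: BrumerEtAl2019, Thm 7.1.3 p. 1187] -/
theorem eulerFactors_agree {N : ℕ} [NeZero N] {A : AbelianVariety ℚ} {f : Matrix (Fin 2) (Fin 2) ℂ → ℂ}
    (h : IsParamodularAwayFrom A N f) {p : ℕ} (hp : p.Prime) (hpN : ¬ p ∣ N) :
    ∃ Q : Polynomial ℚ, HasSpinorEulerFactorAt 2 p f (Q.map (algebraMap ℚ ℂ)) ∧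
      A.HasGoodEulerFactorAt p Q :=
  h.2.2 p hp hpN

/-- For a PRIME level `N` the side condition is `p ≠ N`. [cite: BrumerEtAl2019, Thm 7.1.3 p. 1187; Thm 7.2.1 p. 1189] -/
theorem eulerFactors_agree_of_prime {N : ℕ} [NeZero N] (hN : N.Prime) {A : AbelianVariety ℚ}
    {f : Matrix (Fin 2) (Fin 2) ℂ → ℂ} (h : IsParamodularAwayFrom A N f) {p : ℕ} (hp : p.Prime)
    (hpN : p ≠ N) :
    ∃ Q : Polynomial ℚ, HasSpinorEulerFactorAt 2 p f (Q.map (algebraMap ℚ ℂ)) ∧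
      A.HasGoodEulerFactorAt p Q :=
  eulerFactors_agree h hp (fun hdvd => hpN ((Nat.prime_dvd_prime_iff_eq hp hN).mp hdvd))

/-- **`paramodular_277` re-derived from the template** (same binders; the certificate hypothesis in
either spelling, `certificate277_iff`), as the check that instances are one-liners. [cite: BrumerEtAl2019, Thm 7.1.3 p. 1187] -/
theorem paramodular_277' (hFS : traceEq_of_faltingsSerre_symplectic)
    {A : AbelianVariety ℚ} {f : Matrix (Fin 2) (Fin 2) ℂ → ℂ}
    {ρA ρf : FramedGaloisRep ℚ ℤ_[2] 4} {J : Matrix (Fin 4) (Fin 4) ℤ_[2]}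
    {ν : Field.absoluteGaloisGroup ℚ → ℤ_[2]}
    {b : Module.Basis (Fin 4) ℚ_[2] (A.rationalTateModule 2)}
    (hC : Paramodular277.Certificate277 J ν ρA ρf)
    (hframe : A.IsFrameOfTateRep 2 b (rationalize ρA))
    (aA bA af bf : ℕ → ℤ)
    (hA : ∀ p : ℕ, p.Prime → ¬ p ∣ 277 →
      A.HasGoodEulerFactorAt p ((lPolynomialOfSurface p (aA p) (bA p)).map (Int.castRingHom ℚ)))
    (hρf : ∀ p : ℕ, p.Prime → ¬ p ∣ 277 → p ≠ 2 →
      ∀ v : HeightOneSpectrum (𝓞 ℚ), ((p : ℕ) : 𝓞 ℚ) ∈ v.asIdeal →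
        ρf.HasFrobCharpolyAt v
          ((lPolynomialOfSurface p (af p) (bf p)).reverse.map (Int.castRingHom ℤ_[2])))
    (hcusp : IsParamodularCuspForm 277 2 f) (hne : ∃ Z ∈ siegelUpperHalfSpace 2, f Z ≠ 0)
    (hfe : ∀ p : ℕ, p.Prime → ¬ p ∣ 277 →
      HasSpinorEulerFactorAt 2 p f ((lPolynomialOfSurface p (af p) (bf p)).map (Int.castRingHom ℂ)))
    (h2 : aA 2 = af 2 ∧ bA 2 = bf 2) :
    IsParamodularAwayFrom A 277 f :=
  paramodular_of_surfaceCertificate hFS ((certificate277_iff J ν ρA ρf).mp hC) hframe aA bA af bf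
    hA hρf hcusp hne hfe (fun _ => h2)

end Literature.NumberTheory.FaltingsSerre
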